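import Mathlib.Analysis.Calculus.Deriv.MeanValue
import Mathlib.Analysis.Calculus.Deriv.Inv
import Mathlib.Analysis.Calculus.Deriv.Pow
import Mathlib.Analysis.Calculus.Deriv.Mul
import HarnessLib

/-!
# HHW Proposition 3.1 — the one-step recursion inequalities for the truncated correlations
# (the analytic core, as a theorem about the ODE system (3.6)–(3.9))

Hara–Hattori–Watanabe (Comm. Math. Phys. 220 (2001) 13–40), §3: one renormalisation-group step
`h_N ↦ h_{N+1} = T S h_N` of the `d = 4` hierarchical model is, on the Fourier side, the scaling
`S` followed by the semigroup `g_t = exp(-t d²/dξ²) g` run up to `t = β/2` ((3.3)); along it the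
"potential" `V_t = -log g_t = Σ_n μ_{2n}(t) ξ^{2n}` solves `dV_t/dt = (∇V_t)² - ΔV_t` ((3.4)), i.e.
the truncated correlations satisfy ((3.6)–(3.9))

  `μ₂' = 4μ₂² - 12μ₄`, `μ₄' = 16μ₂μ₄ - 30μ₆`, `μ₆' = 24μ₂μ₆ + 16μ₄² - 56μ₈`,
  `μ₈' = 32μ₂μ₈ + 48μ₄μ₆ - 90μ₁₀`,

and Newman's inequalities give `μ₄, μ₆, μ₈, μ₁₀ ≥ 0` along the flow ((3.10)). Proposition 3.1
bounds `μ_{2n}(β/2)` (`= μ_{2n,N+1}`) in terms of the initial values by comparison with the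
explicit solution `μ̄₂(t) = a/(1 - 4at)` of `μ̄₂' = 4μ̄₂²`, `a = μ₂(0)` ((3.25)–(3.26)), in the
normalised variables `M(t) = 1/(1 - 4at)`, `m̂ = (aM - μ₂)/M²`, `μ̂_{2n} = μ_{2n}/M^{2n}` and the new
time `z = M(t) - 1` ((3.27)–(3.38)).

This file proves exactly that comparison argument, for ARBITRARY real functions satisfying the
ODE system on `[0, T]` with the positivity (3.10) and the subcriticality `4aT < 1` ((3.13)):
`TruncFlow`. We use the time `ζ(t) = (M(t) - 1)/(2a) = 2t/(1 - 4at)` (so that `ζ(β/2) = ζ_N` of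
(3.12) in the application, and no `1/a` appears in the bounds) and write every bound of §3.2 as
"an explicit function of `t` whose derivative has a sign":

* `two_le` — (3.26) `μ₂ ≤ aM` (via `(1/μ₂ + 4t)' = 12μ₄/μ₂² ≥ 0`), whence (3.14);
* `hat4_le`, `mhat_le`, `hat6_le`, `hat8_le` — (3.31), (3.34), (3.32), (3.33);
* `hat4_ge`, `mhat_ge`, `hat6_ge` — (3.35), (3.37), (3.36) (the last via `μ̂₄² ≥ 2A₄μ̂₄ - A₄²`, so
  that no sign condition on the lower bounds is needed for (3.36)–(3.37));
* `hat4_le'` — (3.38), under the endpoint condition (3.16) alone (non-negativity of the lower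
  bound (3.35) at `t = T`, propagated to `[0, T]` by monotonicity in `ζ`, `L4_nonneg`); the
  conditions (3.17) and (3.18) of the paper turn out to be unnecessary (`Lm_nonneg` records the
  propagation of (3.18) anyway);
* `two_T_le`, `two_T_ge`, `two_T_le'`, `four_T_ge`, `four_T_le`, `six_T_le`, `six_T_ge`,
  `eight_T_le` — the conclusions (3.14), (3.15), (3.19)–(3.24) at `t = T`, in terms of
  `M_T = 1/(1 - 4aT)`, `ζ_T = 2T/(1 - 4aT)`, `A₄ = μ₄(0)`, `A₆ = μ₆(0)`, `A₈ = μ₈(0)`.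

With `T = β/2`, `β = (√2 - 1)/2`, `a = μ_{2,N}/√2`, `A₄ = μ_{4,N}/4`, `A₆ = μ_{6,N}/(8√2)`,
`A₈ = μ_{8,N}/32` ((3.2)) one has `M_T = √2 r_N`, `ζ_T = ζ_N` ((3.11)–(3.12)) and these are
(3.14)–(3.24) as printed; that specialisation, and the verification that the truncated correlations
of the tilted laws solve (3.6)–(3.9), are carried out in the companion file on the tilted flow.
All coefficient bookkeeping was checked symbolically before formalisation; the identities are
re-verified here by `ring`.

## References

* T. Hara, T. Hattori, H. Watanabe, *Triviality of hierarchical Ising model in four dimensions*,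
  Comm. Math. Phys. 220 (2001) 13–40, §3 (Proposition 3.1, eqs. (3.6)–(3.9), (3.13)–(3.38)).
-/

noncomputable section

namespace Literature.Barriers.CriticalPhenomena

open _root_.Set

namespace HierarchicalRG

/-! ### Calculus helpers on `[0, T]` -/

/-- A function with a non-negative derivative on `[0, T]` is monotone there. [folklore] -/
theorem monotoneOn_Icc_of_hasDerivAt_nonneg {f f' : ℝ → ℝ} {T : ℝ}
    (hf : ∀ t ∈ Icc (0 : ℝ) T, HasDerivAt f (f' t) t) (hf' : ∀ t ∈ Icc (0 : ℝ) T, 0 ≤ f' t) :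
    MonotoneOn f (Icc 0 T) :=
  monotoneOn_of_hasDerivWithinAt_nonneg (convex_Icc 0 T)
    (fun t ht => (hf t ht).continuousAt.continuousWithinAt)
    (fun t ht => (hf t (interior_subset ht)).hasDerivWithinAt)
    (fun t ht => hf' t (interior_subset ht))

/-- A function with a non-positive derivative on `[0, T]` is antitone there. [folklore] -/
theorem antitoneOn_Icc_of_hasDerivAt_nonpos {f f' : ℝ → ℝ} {T : ℝ}
    (hf : ∀ t ∈ Icc (0 : ℝ) T, HasDerivAt f (f' t) t) (hf' : ∀ t ∈ Icc (0 : ℝ) T, f' t ≤ 0) :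
    AntitoneOn f (Icc 0 T) :=
  antitoneOn_of_hasDerivWithinAt_nonpos (convex_Icc 0 T)
    (fun t ht => (hf t ht).continuousAt.continuousWithinAt)
    (fun t ht => (hf t (interior_subset ht)).hasDerivWithinAt)
    (fun t ht => hf' t (interior_subset ht))

/-- `G' ≥ 0` on `[0, T]` gives `G 0 ≤ G t`. [folklore] -/
theorem apply_zero_le_of_hasDerivAt_nonneg {f f' : ℝ → ℝ} {T : ℝ}
    (hf : ∀ t ∈ Icc (0 : ℝ) T, HasDerivAt f (f' t) t) (hf' : ∀ t ∈ Icc (0 : ℝ) T, 0 ≤ f' t)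
    {t : ℝ} (ht : t ∈ Icc (0 : ℝ) T) : f 0 ≤ f t :=
  monotoneOn_Icc_of_hasDerivAt_nonneg hf hf' (left_mem_Icc.2 (ht.1.trans ht.2)) ht ht.1

/-- `G' ≤ 0` on `[0, T]` gives `G t ≤ G 0`. [folklore] -/
theorem apply_le_apply_zero_of_hasDerivAt_nonpos {f f' : ℝ → ℝ} {T : ℝ}
    (hf : ∀ t ∈ Icc (0 : ℝ) T, HasDerivAt f (f' t) t) (hf' : ∀ t ∈ Icc (0 : ℝ) T, f' t ≤ 0)
    {t : ℝ} (ht : t ∈ Icc (0 : ℝ) T) : f t ≤ f 0 :=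
  antitoneOn_Icc_of_hasDerivAt_nonpos hf hf' (left_mem_Icc.2 (ht.1.trans ht.2)) ht ht.1

/-! ### The hypotheses of Proposition 3.1 -/

/-- **The setting of HHW Proposition 3.1.** Real functions `μ₂, μ₄, μ₆, μ₈, μ₁₀` on `[0, T]`
solving the truncated-correlation flow (3.6)–(3.9) of `dV_t/dt = (∇V_t)² - ΔV_t` ((3.4)), with
Newman's positivity (3.10) for `μ₄, …, μ₁₀`, `μ₂ > 0`, and the subcriticality `4μ₂(0)T < 1`
(for `T = β/2`, `μ₂(0) = μ_{2,N}/√2` this is (3.13), `μ_{2,N} < 2 + √2`).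
[cite: HaraHattoriWatanabe2001, §3.1 eqs. (3.4)–(3.9), §3.2 eqs. (3.10), (3.13)] -/
structure TruncFlow (T : ℝ) (μ₂ μ₄ μ₆ μ₈ μ₁₀ : ℝ → ℝ) : Prop where
  pos : 0 < T
  deriv2 : ∀ t ∈ Icc (0 : ℝ) T, HasDerivAt μ₂ (4 * μ₂ t ^ 2 - 12 * μ₄ t) t
  deriv4 : ∀ t ∈ Icc (0 : ℝ) T, HasDerivAt μ₄ (16 * μ₂ t * μ₄ t - 30 * μ₆ t) t
  deriv6 : ∀ t ∈ Icc (0 : ℝ) T,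
    HasDerivAt μ₆ (24 * μ₂ t * μ₆ t + 16 * μ₄ t ^ 2 - 56 * μ₈ t) t
  deriv8 : ∀ t ∈ Icc (0 : ℝ) T,
    HasDerivAt μ₈ (32 * μ₂ t * μ₈ t + 48 * μ₄ t * μ₆ t - 90 * μ₁₀ t) t
  two_pos : ∀ t ∈ Icc (0 : ℝ) T, 0 < μ₂ t
  four_nonneg : ∀ t ∈ Icc (0 : ℝ) T, 0 ≤ μ₄ t
  six_nonneg : ∀ t ∈ Icc (0 : ℝ) T, 0 ≤ μ₆ t
  eight_nonneg : ∀ t ∈ Icc (0 : ℝ) T, 0 ≤ μ₈ t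
  ten_nonneg : ∀ t ∈ Icc (0 : ℝ) T, 0 ≤ μ₁₀ t
  subcrit : 4 * μ₂ 0 * T < 1

/-! ### The normalised variables -/

/-- `M(t) = 1/(1 - 4at)`, the ratio `μ̄₂(t)/a` for the majorant `μ̄₂' = 4μ̄₂²` ((3.25)–(3.26)).
[cite: HaraHattoriWatanabe2001, §3.2 (p. 9, `M(t)`)] -/
def bigM (a t : ℝ) : ℝ := (1 - 4 * a * t)⁻¹

/-- The new time `ζ(t) = (M(t) - 1)/(2a) = 2t/(1 - 4at)` (the paper's `z = M - 1` divided by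
`2a = √2 μ_{2,N}`, so that `ζ(β/2) = ζ_N` of (3.12)). [cite: HaraHattoriWatanabe2001, §3.2 (p. 9)] -/
def zetaF (a t : ℝ) : ℝ := 2 * t / (1 - 4 * a * t)

/-- `m̂ = m/M² = (aM - μ₂)/M² = a(1 - 4at) - μ₂(1 - 4at)²`. [cite: HaraHattoriWatanabe2001, §3.2 (p. 9)] -/
def mhat (a : ℝ) (μ₂ : ℝ → ℝ) (t : ℝ) : ℝ := a * (1 - 4 * a * t) - μ₂ t * (1 - 4 * a * t) ^ 2

/-- `μ̂_{k} = μ_k/M^k = μ_k (1 - 4at)^k` (used for `k = 4, 6, 8, 10`).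
[cite: HaraHattoriWatanabe2001, §3.2 (p. 9)] -/
def hat (k : ℕ) (a : ℝ) (μ : ℝ → ℝ) (t : ℝ) : ℝ := μ t * (1 - 4 * a * t) ^ k

/-- `M(0) = 1`. [folklore] -/
@[simp] theorem bigM_zero (a : ℝ) : bigM a 0 = 1 := by simp [bigM]
/-- `ζ(0) = 0`. [folklore] -/
@[simp] theorem zetaF_zero (a : ℝ) : zetaF a 0 = 0 := by simp [zetaF]
/-- `μ̂_k(0) = μ_k(0)`. [folklore] -/
@[simp] theorem hat_zero (k : ℕ) (a : ℝ) (μ : ℝ → ℝ) : hat k a μ 0 = μ 0 := by simp [hat]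
/-- `m̂(0) = a - μ₂(0)` (`= 0` for `a = μ₂(0)`). [folklore] -/
@[simp] theorem mhat_zero (a : ℝ) (μ₂ : ℝ → ℝ) : mhat a μ₂ 0 = a - μ₂ 0 := by simp [mhat]

/-- `ζ' = 2M² = 2/(1 - 4at)²`. [folklore] -/
theorem hasDerivAt_zetaF {a t : ℝ} (hD : 1 - 4 * a * t ≠ 0) :
    HasDerivAt (zetaF a) (2 / (1 - 4 * a * t) ^ 2) t := by
  have h1 : HasDerivAt (fun t => 1 - 4 * a * t) (-(4 * a)) t := by
    simpa using ((hasDerivAt_id t).const_mul (4 * a)).const_sub 1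
  have h2 : HasDerivAt (fun t => 2 * t) 2 t := by
    simpa using (hasDerivAt_id t).const_mul 2
  have h3 := h2.div h1 hD
  have hf : zetaF a = fun t => 2 * t / (1 - 4 * a * t) := rfl
  rw [hf]
  refine h3.congr_deriv ?_
  rw [div_eq_div_iff (pow_ne_zero 2 hD) (pow_ne_zero 2 hD)]
  ring

namespace TruncFlow

variable {T : ℝ} {μ₂ μ₄ μ₆ μ₈ μ₁₀ : ℝ → ℝ}

/-! ### Elementary consequences of the hypotheses -/

/-- `a = μ₂(0) > 0`. [folklore] -/
theorem a_pos (h : TruncFlow T μ₂ μ₄ μ₆ μ₈ μ₁₀) : 0 < μ₂ 0 :=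
  h.two_pos 0 ⟨le_rfl, h.pos.le⟩

/-- `1 - 4at > 0` on `[0, T]` (subcriticality). [folklore] -/
theorem D_pos (h : TruncFlow T μ₂ μ₄ μ₆ μ₈ μ₁₀) {t : ℝ} (ht : t ∈ Icc (0 : ℝ) T) :
    0 < 1 - 4 * μ₂ 0 * t := by
  have := h.a_pos
  nlinarith [h.subcrit, ht.2]

/-- `1 - 4at ≤ 1` on `[0, T]`. [folklore] -/
theorem D_le_one (h : TruncFlow T μ₂ μ₄ μ₆ μ₈ μ₁₀) {t : ℝ} (ht : t ∈ Icc (0 : ℝ) T) :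
    1 - 4 * μ₂ 0 * t ≤ 1 := by
  have := h.a_pos
  nlinarith [ht.1]

/-- `M > 0` on `[0, T]`. [folklore] -/
theorem bigM_pos (h : TruncFlow T μ₂ μ₄ μ₆ μ₈ μ₁₀) {t : ℝ} (ht : t ∈ Icc (0 : ℝ) T) :
    0 < bigM (μ₂ 0) t :=
  inv_pos.2 (h.D_pos ht)

/-- `ζ ≥ 0` on `[0, T]`. [folklore] -/
theorem zetaF_nonneg (h : TruncFlow T μ₂ μ₄ μ₆ μ₈ μ₁₀) {t : ℝ} (ht : t ∈ Icc (0 : ℝ) T) :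
    0 ≤ zetaF (μ₂ 0) t :=
  div_nonneg (by linarith [ht.1]) (h.D_pos ht).le

/-- `ζ` is monotone on `[0, T]`: `ζ(t) ≤ ζ(T)`. [folklore] -/
theorem zetaF_le (h : TruncFlow T μ₂ μ₄ μ₆ μ₈ μ₁₀) {t : ℝ} (ht : t ∈ Icc (0 : ℝ) T) :
    zetaF (μ₂ 0) t ≤ zetaF (μ₂ 0) T := by
  have hT : T ∈ Icc (0 : ℝ) T := ⟨h.pos.le, le_rfl⟩
  unfold zetaF
  rw [div_le_div_iff₀ (h.D_pos ht) (h.D_pos hT)]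
  have := h.a_pos
  nlinarith [ht.1, ht.2]

/-- `μ̂_k ≥ 0` when `μ_k ≥ 0`. [folklore] -/
theorem hat_nonneg (h : TruncFlow T μ₂ μ₄ μ₆ μ₈ μ₁₀) (k : ℕ) {μ : ℝ → ℝ} {t : ℝ}
    (ht : t ∈ Icc (0 : ℝ) T) (hμ : 0 ≤ μ t) : 0 ≤ hat k (μ₂ 0) μ t :=
  mul_nonneg hμ (pow_nonneg (h.D_pos ht).le k)

/-! ### (3.26): `μ₂ ≤ μ̄₂ = aM` -/

/-- **(3.26)**: `μ₂(t) ≤ μ̄₂(t) = a/(1 - 4at)` on `[0, T]` — the solution of `μ̄₂' = 4μ̄₂²`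
majorises `μ₂' = 4μ₂² - 12μ₄ ≤ 4μ₂²` (here via the monotonicity of `1/μ₂ + 4t`).
[cite: HaraHattoriWatanabe2001, §3.2 eqs. (3.25)–(3.26)] -/
theorem two_le (h : TruncFlow T μ₂ μ₄ μ₆ μ₈ μ₁₀) {t : ℝ} (ht : t ∈ Icc (0 : ℝ) T) :
    μ₂ t ≤ μ₂ 0 * bigM (μ₂ 0) t := by
  -- `φ = 1/μ₂ + 4t` has `φ' = 12 μ₄/μ₂² ≥ 0`
  have hφ : ∀ u ∈ Icc (0 : ℝ) T, HasDerivAt (fun u => (μ₂ u)⁻¹ + 4 * u)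
      (-(4 * μ₂ u ^ 2 - 12 * μ₄ u) / μ₂ u ^ 2 + 4 * 1) u := fun u hu =>
    ((h.deriv2 u hu).inv (h.two_pos u hu).ne').add ((hasDerivAt_id u).const_mul 4)
  have hφ' : ∀ u ∈ Icc (0 : ℝ) T, 0 ≤ -(4 * μ₂ u ^ 2 - 12 * μ₄ u) / μ₂ u ^ 2 + 4 * 1 := by
    intro u hu
    have h2 := h.two_pos u hu
    have : -(4 * μ₂ u ^ 2 - 12 * μ₄ u) / μ₂ u ^ 2 + 4 * 1 = 12 * μ₄ u / μ₂ u ^ 2 := by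
      field_simp; ring
    rw [this]
    exact div_nonneg (by linarith [h.four_nonneg u hu]) (sq_nonneg _)
  have key := apply_zero_le_of_hasDerivAt_nonneg hφ hφ' ht
  simp only [mul_zero, add_zero] at key
  -- `1/μ₂(t) ≥ 1/a - 4t = (1 - 4at)/a > 0`
  have ha := h.a_pos
  have hD := h.D_pos ht
  have h2 := h.two_pos t ht
  have hlow : (1 - 4 * μ₂ 0 * t) / μ₂ 0 ≤ (μ₂ t)⁻¹ := by
    have : (1 - 4 * μ₂ 0 * t) / μ₂ 0 = (μ₂ 0)⁻¹ - 4 * t := by field_simp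
    rw [this]; linarith
  have hpos : 0 < (1 - 4 * μ₂ 0 * t) / μ₂ 0 := div_pos hD ha
  calc μ₂ t = ((μ₂ t)⁻¹)⁻¹ := (inv_inv _).symm
    _ ≤ ((1 - 4 * μ₂ 0 * t) / μ₂ 0)⁻¹ := (inv_le_inv₀ (inv_pos.2 h2) hpos).2 hlow
    _ = μ₂ 0 * bigM (μ₂ 0) t := by unfold bigM; rw [inv_div]; field_simp

/-- `m̂ ≥ 0` ((3.26) in the normalised variables). [cite: HaraHattoriWatanabe2001, §3.2 (p. 9, `m(t) ≥ 0`)] -/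
theorem mhat_nonneg (h : TruncFlow T μ₂ μ₄ μ₆ μ₈ μ₁₀) {t : ℝ} (ht : t ∈ Icc (0 : ℝ) T) :
    0 ≤ mhat (μ₂ 0) μ₂ t := by
  have hle := h.two_le ht
  have hD := h.D_pos ht
  unfold mhat
  unfold bigM at hle
  have : μ₂ t * (1 - 4 * μ₂ 0 * t) ≤ μ₂ 0 := by
    rw [← le_div_iff₀ hD]; simpa [div_eq_mul_inv] using hle
  nlinarith

/-! ### The flow in the normalised variables ((3.27)–(3.30)) -/

/-- `(1 - 4at)' = -4a`. [folklore] -/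
theorem hasDerivAt_D (a t : ℝ) : HasDerivAt (fun t => 1 - 4 * a * t) (-(4 * a)) t := by
  simpa using ((hasDerivAt_id t).const_mul (4 * a)).const_sub 1

/-- **(3.30)**: `m̂' = M²(12μ̂₄ - 4m̂²)` (`M² = 1/(1 - 4at)²`). [cite: HaraHattoriWatanabe2001, §3.2 eq. (3.30)] -/
theorem hasDerivAt_mhat (h : TruncFlow T μ₂ μ₄ μ₆ μ₈ μ₁₀) {t : ℝ} (ht : t ∈ Icc (0 : ℝ) T) :
    HasDerivAt (mhat (μ₂ 0) μ₂)
      ((12 * hat 4 (μ₂ 0) μ₄ t - 4 * mhat (μ₂ 0) μ₂ t ^ 2) / (1 - 4 * μ₂ 0 * t) ^ 2) t := by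
  have hD := (h.D_pos ht).ne'
  have raw : HasDerivAt (mhat (μ₂ 0) μ₂)
      (μ₂ 0 * (-(4 * μ₂ 0)) - ((4 * μ₂ t ^ 2 - 12 * μ₄ t) * (1 - 4 * μ₂ 0 * t) ^ 2 +
        μ₂ t * (2 * (1 - 4 * μ₂ 0 * t) ^ 1 * (-(4 * μ₂ 0))))) t := by
    unfold mhat
    exact ((hasDerivAt_D (μ₂ 0) t).const_mul (μ₂ 0)).sub
      ((h.deriv2 t ht).mul ((hasDerivAt_D (μ₂ 0) t).pow 2))
  refine raw.congr_deriv ?_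
  unfold hat mhat
  rw [eq_div_iff (pow_ne_zero 2 hD)]
  ring

/-- **(3.27)**: `μ̂₄' = M²(-16 m̂ μ̂₄ - 30 μ̂₆)`. [cite: HaraHattoriWatanabe2001, §3.2 eq. (3.27)] -/
theorem hasDerivAt_hat4 (h : TruncFlow T μ₂ μ₄ μ₆ μ₈ μ₁₀) {t : ℝ} (ht : t ∈ Icc (0 : ℝ) T) :
    HasDerivAt (hat 4 (μ₂ 0) μ₄)
      ((-16 * mhat (μ₂ 0) μ₂ t * hat 4 (μ₂ 0) μ₄ t - 30 * hat 6 (μ₂ 0) μ₆ t) /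
        (1 - 4 * μ₂ 0 * t) ^ 2) t := by
  have hD := (h.D_pos ht).ne'
  have raw : HasDerivAt (hat 4 (μ₂ 0) μ₄)
      ((16 * μ₂ t * μ₄ t - 30 * μ₆ t) * (1 - 4 * μ₂ 0 * t) ^ 4 +
        μ₄ t * (4 * (1 - 4 * μ₂ 0 * t) ^ 3 * (-(4 * μ₂ 0)))) t := by
    unfold hat
    exact (h.deriv4 t ht).mul ((hasDerivAt_D (μ₂ 0) t).pow 4)
  refine raw.congr_deriv ?_
  unfold hat mhat
  rw [eq_div_iff (pow_ne_zero 2 hD)]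
  ring

/-- **(3.28)**: `μ̂₆' = M²(16 μ̂₄² - 24 m̂ μ̂₆ - 56 μ̂₈)`. [cite: HaraHattoriWatanabe2001, §3.2 eq. (3.28)] -/
theorem hasDerivAt_hat6 (h : TruncFlow T μ₂ μ₄ μ₆ μ₈ μ₁₀) {t : ℝ} (ht : t ∈ Icc (0 : ℝ) T) :
    HasDerivAt (hat 6 (μ₂ 0) μ₆)
      ((16 * hat 4 (μ₂ 0) μ₄ t ^ 2 - 24 * mhat (μ₂ 0) μ₂ t * hat 6 (μ₂ 0) μ₆ t -
          56 * hat 8 (μ₂ 0) μ₈ t) / (1 - 4 * μ₂ 0 * t) ^ 2) t := by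
  have hD := (h.D_pos ht).ne'
  have raw : HasDerivAt (hat 6 (μ₂ 0) μ₆)
      ((24 * μ₂ t * μ₆ t + 16 * μ₄ t ^ 2 - 56 * μ₈ t) * (1 - 4 * μ₂ 0 * t) ^ 6 +
        μ₆ t * (6 * (1 - 4 * μ₂ 0 * t) ^ 5 * (-(4 * μ₂ 0)))) t := by
    unfold hat
    exact (h.deriv6 t ht).mul ((hasDerivAt_D (μ₂ 0) t).pow 6)
  refine raw.congr_deriv ?_
  unfold hat mhat
  rw [eq_div_iff (pow_ne_zero 2 hD)]
  ring

/-- **(3.29)**: `μ̂₈' = M²(48 μ̂₄μ̂₆ - 32 m̂ μ̂₈ - 90 μ̂₁₀)`. [cite: HaraHattoriWatanabe2001, §3.2 eq. (3.29)] -/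
theorem hasDerivAt_hat8 (h : TruncFlow T μ₂ μ₄ μ₆ μ₈ μ₁₀) {t : ℝ} (ht : t ∈ Icc (0 : ℝ) T) :
    HasDerivAt (hat 8 (μ₂ 0) μ₈)
      ((48 * hat 4 (μ₂ 0) μ₄ t * hat 6 (μ₂ 0) μ₆ t - 32 * mhat (μ₂ 0) μ₂ t * hat 8 (μ₂ 0) μ₈ t -
          90 * hat 10 (μ₂ 0) μ₁₀ t) / (1 - 4 * μ₂ 0 * t) ^ 2) t := by
  have hD := (h.D_pos ht).ne'
  have raw : HasDerivAt (hat 8 (μ₂ 0) μ₈)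
      ((32 * μ₂ t * μ₈ t + 48 * μ₄ t * μ₆ t - 90 * μ₁₀ t) * (1 - 4 * μ₂ 0 * t) ^ 8 +
        μ₈ t * (8 * (1 - 4 * μ₂ 0 * t) ^ 7 * (-(4 * μ₂ 0)))) t := by
    unfold hat
    exact (h.deriv8 t ht).mul ((hasDerivAt_D (μ₂ 0) t).pow 8)
  refine raw.congr_deriv ?_
  unfold hat mhat
  rw [eq_div_iff (pow_ne_zero 2 hD)]
  ring

/-! ### Upper bounds (3.31)–(3.34) -/

/-- **(3.31)**: `μ̂₄ ≤ A₄ = μ₄(0)` (`μ̂₄' ≤ 0`). [cite: HaraHattoriWatanabe2001, §3.2 eq. (3.31)] -/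
theorem hat4_le (h : TruncFlow T μ₂ μ₄ μ₆ μ₈ μ₁₀) {t : ℝ} (ht : t ∈ Icc (0 : ℝ) T) :
    hat 4 (μ₂ 0) μ₄ t ≤ μ₄ 0 := by
  have hderiv : ∀ u ∈ Icc (0 : ℝ) T,
      (-16 * mhat (μ₂ 0) μ₂ u * hat 4 (μ₂ 0) μ₄ u - 30 * hat 6 (μ₂ 0) μ₆ u) /
        (1 - 4 * μ₂ 0 * u) ^ 2 ≤ 0 := by
    intro u hu
    have hm := h.mhat_nonneg hu
    have h4 := h.hat_nonneg 4 hu (h.four_nonneg u hu)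
    have h6 := h.hat_nonneg 6 hu (h.six_nonneg u hu)
    exact div_nonpos_of_nonpos_of_nonneg (by nlinarith [mul_nonneg hm h4]) (sq_nonneg _)
  have key := apply_le_apply_zero_of_hasDerivAt_nonpos (fun u hu => h.hasDerivAt_hat4 hu) hderiv ht
  simpa using key

/-- **(3.34)**: `m̂ ≤ 6A₄ζ`. [cite: HaraHattoriWatanabe2001, §3.2 eq. (3.34)] -/
theorem mhat_le (h : TruncFlow T μ₂ μ₄ μ₆ μ₈ μ₁₀) {t : ℝ} (ht : t ∈ Icc (0 : ℝ) T) :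
    mhat (μ₂ 0) μ₂ t ≤ 6 * μ₄ 0 * zetaF (μ₂ 0) t := by
  have hG : ∀ u ∈ Icc (0 : ℝ) T, HasDerivAt (fun u => 6 * μ₄ 0 * zetaF (μ₂ 0) u - mhat (μ₂ 0) μ₂ u)
      (6 * μ₄ 0 * (2 / (1 - 4 * μ₂ 0 * u) ^ 2) -
        (12 * hat 4 (μ₂ 0) μ₄ u - 4 * mhat (μ₂ 0) μ₂ u ^ 2) / (1 - 4 * μ₂ 0 * u) ^ 2) u :=
    fun u hu => ((hasDerivAt_zetaF (h.D_pos hu).ne').const_mul _).sub (h.hasDerivAt_mhat hu)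
  have hG' : ∀ u ∈ Icc (0 : ℝ) T, 0 ≤ 6 * μ₄ 0 * (2 / (1 - 4 * μ₂ 0 * u) ^ 2) -
        (12 * hat 4 (μ₂ 0) μ₄ u - 4 * mhat (μ₂ 0) μ₂ u ^ 2) / (1 - 4 * μ₂ 0 * u) ^ 2 := by
    intro u hu
    have h4le := h.hat4_le hu
    have heq : 6 * μ₄ 0 * (2 / (1 - 4 * μ₂ 0 * u) ^ 2) -
        (12 * hat 4 (μ₂ 0) μ₄ u - 4 * mhat (μ₂ 0) μ₂ u ^ 2) / (1 - 4 * μ₂ 0 * u) ^ 2 =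
        (12 * (μ₄ 0 - hat 4 (μ₂ 0) μ₄ u) + 4 * mhat (μ₂ 0) μ₂ u ^ 2) *
          ((1 - 4 * μ₂ 0 * u) ^ 2)⁻¹ := by ring
    rw [heq]
    exact mul_nonneg (by nlinarith [sq_nonneg (mhat (μ₂ 0) μ₂ u)]) (inv_nonneg.2 (sq_nonneg _))
  have key := apply_zero_le_of_hasDerivAt_nonneg hG hG' ht
  simp only [zetaF_zero, mul_zero, mhat_zero, sub_self, sub_nonneg] at key
  linarith

/-- **(3.32)**: `μ̂₆ ≤ A₆ + 8A₄²ζ`. [cite: HaraHattoriWatanabe2001, §3.2 eq. (3.32)] -/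
theorem hat6_le (h : TruncFlow T μ₂ μ₄ μ₆ μ₈ μ₁₀) {t : ℝ} (ht : t ∈ Icc (0 : ℝ) T) :
    hat 6 (μ₂ 0) μ₆ t ≤ μ₆ 0 + 8 * μ₄ 0 ^ 2 * zetaF (μ₂ 0) t := by
  have hG : ∀ u ∈ Icc (0 : ℝ) T,
      HasDerivAt (fun u => μ₆ 0 + 8 * μ₄ 0 ^ 2 * zetaF (μ₂ 0) u - hat 6 (μ₂ 0) μ₆ u)
      (8 * μ₄ 0 ^ 2 * (2 / (1 - 4 * μ₂ 0 * u) ^ 2) -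
        (16 * hat 4 (μ₂ 0) μ₄ u ^ 2 - 24 * mhat (μ₂ 0) μ₂ u * hat 6 (μ₂ 0) μ₆ u -
          56 * hat 8 (μ₂ 0) μ₈ u) / (1 - 4 * μ₂ 0 * u) ^ 2) u :=
    fun u hu => (((hasDerivAt_zetaF (h.D_pos hu).ne').const_mul _).const_add _).sub
      (h.hasDerivAt_hat6 hu)
  have hG' : ∀ u ∈ Icc (0 : ℝ) T, 0 ≤ 8 * μ₄ 0 ^ 2 * (2 / (1 - 4 * μ₂ 0 * u) ^ 2) -
        (16 * hat 4 (μ₂ 0) μ₄ u ^ 2 - 24 * mhat (μ₂ 0) μ₂ u * hat 6 (μ₂ 0) μ₆ u -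
          56 * hat 8 (μ₂ 0) μ₈ u) / (1 - 4 * μ₂ 0 * u) ^ 2 := by
    intro u hu
    have hm := h.mhat_nonneg hu
    have h4 := h.hat_nonneg 4 hu (h.four_nonneg u hu)
    have h6 := h.hat_nonneg 6 hu (h.six_nonneg u hu)
    have h8 := h.hat_nonneg 8 hu (h.eight_nonneg u hu)
    have h4le := h.hat4_le hu
    have heq : 8 * μ₄ 0 ^ 2 * (2 / (1 - 4 * μ₂ 0 * u) ^ 2) -
        (16 * hat 4 (μ₂ 0) μ₄ u ^ 2 - 24 * mhat (μ₂ 0) μ₂ u * hat 6 (μ₂ 0) μ₆ u -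
          56 * hat 8 (μ₂ 0) μ₈ u) / (1 - 4 * μ₂ 0 * u) ^ 2 =
        (16 * (μ₄ 0 ^ 2 - hat 4 (μ₂ 0) μ₄ u ^ 2) + 24 * mhat (μ₂ 0) μ₂ u * hat 6 (μ₂ 0) μ₆ u +
          56 * hat 8 (μ₂ 0) μ₈ u) * ((1 - 4 * μ₂ 0 * u) ^ 2)⁻¹ := by ring
    rw [heq]
    refine mul_nonneg ?_ (inv_nonneg.2 (sq_nonneg _))
    nlinarith [mul_nonneg hm h6, mul_nonneg h4 (sub_nonneg.2 h4le)]
  have key := apply_zero_le_of_hasDerivAt_nonneg hG hG' ht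
  simp only [zetaF_zero, mul_zero, add_zero, hat_zero, sub_self, sub_nonneg] at key
  linarith

/-- **(3.33)**: `μ̂₈ ≤ A₈ + 24A₄A₆ζ + 96A₄³ζ²`. [cite: HaraHattoriWatanabe2001, §3.2 eq. (3.33)] -/
theorem hat8_le (h : TruncFlow T μ₂ μ₄ μ₆ μ₈ μ₁₀) {t : ℝ} (ht : t ∈ Icc (0 : ℝ) T) :
    hat 8 (μ₂ 0) μ₈ t ≤
      μ₈ 0 + 24 * μ₄ 0 * μ₆ 0 * zetaF (μ₂ 0) t + 96 * μ₄ 0 ^ 3 * zetaF (μ₂ 0) t ^ 2 := by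
  have hG : ∀ u ∈ Icc (0 : ℝ) T,
      HasDerivAt (fun u => μ₈ 0 + 24 * μ₄ 0 * μ₆ 0 * zetaF (μ₂ 0) u +
        96 * μ₄ 0 ^ 3 * zetaF (μ₂ 0) u ^ 2 - hat 8 (μ₂ 0) μ₈ u)
      (24 * μ₄ 0 * μ₆ 0 * (2 / (1 - 4 * μ₂ 0 * u) ^ 2) +
        96 * μ₄ 0 ^ 3 * (↑(2 : ℕ) * zetaF (μ₂ 0) u ^ (2 - 1) * (2 / (1 - 4 * μ₂ 0 * u) ^ 2)) -
        (48 * hat 4 (μ₂ 0) μ₄ u * hat 6 (μ₂ 0) μ₆ u - 32 * mhat (μ₂ 0) μ₂ u * hat 8 (μ₂ 0) μ₈ u -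
          90 * hat 10 (μ₂ 0) μ₁₀ u) / (1 - 4 * μ₂ 0 * u) ^ 2) u := by
    intro u hu
    have hz := hasDerivAt_zetaF (h.D_pos hu).ne'
    exact (((hz.const_mul _).const_add _).add ((hz.pow 2).const_mul _)).sub (h.hasDerivAt_hat8 hu)
  have hG' : ∀ u ∈ Icc (0 : ℝ) T, 0 ≤ 24 * μ₄ 0 * μ₆ 0 * (2 / (1 - 4 * μ₂ 0 * u) ^ 2) +
        96 * μ₄ 0 ^ 3 * (↑(2 : ℕ) * zetaF (μ₂ 0) u ^ (2 - 1) * (2 / (1 - 4 * μ₂ 0 * u) ^ 2)) -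
        (48 * hat 4 (μ₂ 0) μ₄ u * hat 6 (μ₂ 0) μ₆ u - 32 * mhat (μ₂ 0) μ₂ u * hat 8 (μ₂ 0) μ₈ u -
          90 * hat 10 (μ₂ 0) μ₁₀ u) / (1 - 4 * μ₂ 0 * u) ^ 2 := by
    intro u hu
    have hm := h.mhat_nonneg hu
    have h4 := h.hat_nonneg 4 hu (h.four_nonneg u hu)
    have h6 := h.hat_nonneg 6 hu (h.six_nonneg u hu)
    have h8 := h.hat_nonneg 8 hu (h.eight_nonneg u hu)
    have h10 := h.hat_nonneg 10 hu (h.ten_nonneg u hu)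
    have hA4 : 0 ≤ μ₄ 0 := h.four_nonneg 0 ⟨le_rfl, h.pos.le⟩
    have h46 : hat 4 (μ₂ 0) μ₄ u * hat 6 (μ₂ 0) μ₆ u ≤
        μ₄ 0 * (μ₆ 0 + 8 * μ₄ 0 ^ 2 * zetaF (μ₂ 0) u) :=
      mul_le_mul (h.hat4_le hu) (h.hat6_le hu) h6 hA4
    have heq : 24 * μ₄ 0 * μ₆ 0 * (2 / (1 - 4 * μ₂ 0 * u) ^ 2) +
        96 * μ₄ 0 ^ 3 * (↑(2 : ℕ) * zetaF (μ₂ 0) u ^ (2 - 1) * (2 / (1 - 4 * μ₂ 0 * u) ^ 2)) -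
        (48 * hat 4 (μ₂ 0) μ₄ u * hat 6 (μ₂ 0) μ₆ u - 32 * mhat (μ₂ 0) μ₂ u * hat 8 (μ₂ 0) μ₈ u -
          90 * hat 10 (μ₂ 0) μ₁₀ u) / (1 - 4 * μ₂ 0 * u) ^ 2 =
        (48 * (μ₄ 0 * (μ₆ 0 + 8 * μ₄ 0 ^ 2 * zetaF (μ₂ 0) u) -
            hat 4 (μ₂ 0) μ₄ u * hat 6 (μ₂ 0) μ₆ u) +
          32 * mhat (μ₂ 0) μ₂ u * hat 8 (μ₂ 0) μ₈ u + 90 * hat 10 (μ₂ 0) μ₁₀ u) *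
          ((1 - 4 * μ₂ 0 * u) ^ 2)⁻¹ := by push_cast; ring
    rw [heq]
    refine mul_nonneg ?_ (inv_nonneg.2 (sq_nonneg _))
    nlinarith [mul_nonneg hm h8]
  have key := apply_zero_le_of_hasDerivAt_nonneg hG hG' ht
  simp only [zetaF_zero, mul_zero, add_zero, hat_zero, sub_self, sub_nonneg, ne_eq,
    OfNat.ofNat_ne_zero, not_false_eq_true, zero_pow] at key
  linarith

/-! ### Lower bounds (3.35)–(3.37) -/

/-- **(3.35)**: `μ̂₄ ≥ A₄ - 15A₆ζ - 84A₄²ζ²`. [cite: HaraHattoriWatanabe2001, §3.2 eq. (3.35)] -/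
theorem hat4_ge (h : TruncFlow T μ₂ μ₄ μ₆ μ₈ μ₁₀) {t : ℝ} (ht : t ∈ Icc (0 : ℝ) T) :
    μ₄ 0 - 15 * μ₆ 0 * zetaF (μ₂ 0) t - 84 * μ₄ 0 ^ 2 * zetaF (μ₂ 0) t ^ 2 ≤
      hat 4 (μ₂ 0) μ₄ t := by
  have hG : ∀ u ∈ Icc (0 : ℝ) T,
      HasDerivAt (fun u => hat 4 (μ₂ 0) μ₄ u -
        (μ₄ 0 - 15 * μ₆ 0 * zetaF (μ₂ 0) u - 84 * μ₄ 0 ^ 2 * zetaF (μ₂ 0) u ^ 2))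
      ((-16 * mhat (μ₂ 0) μ₂ u * hat 4 (μ₂ 0) μ₄ u - 30 * hat 6 (μ₂ 0) μ₆ u) /
          (1 - 4 * μ₂ 0 * u) ^ 2 -
        (-(15 * μ₆ 0 * (2 / (1 - 4 * μ₂ 0 * u) ^ 2)) -
          84 * μ₄ 0 ^ 2 * (↑(2 : ℕ) * zetaF (μ₂ 0) u ^ (2 - 1) * (2 / (1 - 4 * μ₂ 0 * u) ^ 2)))) u := by
    intro u hu
    have hz := hasDerivAt_zetaF (h.D_pos hu).ne'
    exact (h.hasDerivAt_hat4 hu).sub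
      (((hz.const_mul _).const_sub _).sub ((hz.pow 2).const_mul _))
  have hG' : ∀ u ∈ Icc (0 : ℝ) T, 0 ≤
      (-16 * mhat (μ₂ 0) μ₂ u * hat 4 (μ₂ 0) μ₄ u - 30 * hat 6 (μ₂ 0) μ₆ u) /
          (1 - 4 * μ₂ 0 * u) ^ 2 -
        (-(15 * μ₆ 0 * (2 / (1 - 4 * μ₂ 0 * u) ^ 2)) -
          84 * μ₄ 0 ^ 2 * (↑(2 : ℕ) * zetaF (μ₂ 0) u ^ (2 - 1) * (2 / (1 - 4 * μ₂ 0 * u) ^ 2))) := by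
    intro u hu
    have hm := h.mhat_nonneg hu
    have h4 := h.hat_nonneg 4 hu (h.four_nonneg u hu)
    have hA4 : 0 ≤ μ₄ 0 := h.four_nonneg 0 ⟨le_rfl, h.pos.le⟩
    have hζ := h.zetaF_nonneg hu
    have hm4 : mhat (μ₂ 0) μ₂ u * hat 4 (μ₂ 0) μ₄ u ≤ 6 * μ₄ 0 * zetaF (μ₂ 0) u * μ₄ 0 :=
      mul_le_mul (h.mhat_le hu) (h.hat4_le hu) h4 (by positivity)
    have h6le := h.hat6_le hu
    have heq : (-16 * mhat (μ₂ 0) μ₂ u * hat 4 (μ₂ 0) μ₄ u - 30 * hat 6 (μ₂ 0) μ₆ u) /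
          (1 - 4 * μ₂ 0 * u) ^ 2 -
        (-(15 * μ₆ 0 * (2 / (1 - 4 * μ₂ 0 * u) ^ 2)) -
          84 * μ₄ 0 ^ 2 * (↑(2 : ℕ) * zetaF (μ₂ 0) u ^ (2 - 1) * (2 / (1 - 4 * μ₂ 0 * u) ^ 2))) =
        (16 * (6 * μ₄ 0 * zetaF (μ₂ 0) u * μ₄ 0 - mhat (μ₂ 0) μ₂ u * hat 4 (μ₂ 0) μ₄ u) +
          30 * (μ₆ 0 + 8 * μ₄ 0 ^ 2 * zetaF (μ₂ 0) u - hat 6 (μ₂ 0) μ₆ u)) *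
          ((1 - 4 * μ₂ 0 * u) ^ 2)⁻¹ := by push_cast; ring
    rw [heq]
    refine mul_nonneg ?_ (inv_nonneg.2 (sq_nonneg _))
    nlinarith
  have key := apply_zero_le_of_hasDerivAt_nonneg hG hG' ht
  simp only [zetaF_zero, mul_zero, hat_zero, sub_zero, ne_eq, OfNat.ofNat_ne_zero,
    not_false_eq_true, zero_pow, sub_self] at key
  linarith

/-- **(3.37)**: `m̂ ≥ 6A₄ζ - 45A₆ζ² - 192A₄²ζ³`. [cite: HaraHattoriWatanabe2001, §3.2 eq. (3.37)] -/
theorem mhat_ge (h : TruncFlow T μ₂ μ₄ μ₆ μ₈ μ₁₀) {t : ℝ} (ht : t ∈ Icc (0 : ℝ) T) :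
    6 * μ₄ 0 * zetaF (μ₂ 0) t - 45 * μ₆ 0 * zetaF (μ₂ 0) t ^ 2 -
        192 * μ₄ 0 ^ 2 * zetaF (μ₂ 0) t ^ 3 ≤ mhat (μ₂ 0) μ₂ t := by
  have hG : ∀ u ∈ Icc (0 : ℝ) T,
      HasDerivAt (fun u => mhat (μ₂ 0) μ₂ u - (6 * μ₄ 0 * zetaF (μ₂ 0) u -
        45 * μ₆ 0 * zetaF (μ₂ 0) u ^ 2 - 192 * μ₄ 0 ^ 2 * zetaF (μ₂ 0) u ^ 3))
      ((12 * hat 4 (μ₂ 0) μ₄ u - 4 * mhat (μ₂ 0) μ₂ u ^ 2) / (1 - 4 * μ₂ 0 * u) ^ 2 -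
        (6 * μ₄ 0 * (2 / (1 - 4 * μ₂ 0 * u) ^ 2) -
          45 * μ₆ 0 * (↑(2 : ℕ) * zetaF (μ₂ 0) u ^ (2 - 1) * (2 / (1 - 4 * μ₂ 0 * u) ^ 2)) -
          192 * μ₄ 0 ^ 2 * (↑(3 : ℕ) * zetaF (μ₂ 0) u ^ (3 - 1) * (2 / (1 - 4 * μ₂ 0 * u) ^ 2)))) u := by
    intro u hu
    have hz := hasDerivAt_zetaF (h.D_pos hu).ne'
    exact (h.hasDerivAt_mhat hu).sub
      (((hz.const_mul _).sub ((hz.pow 2).const_mul _)).sub ((hz.pow 3).const_mul _))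
  have hG' : ∀ u ∈ Icc (0 : ℝ) T, 0 ≤
      (12 * hat 4 (μ₂ 0) μ₄ u - 4 * mhat (μ₂ 0) μ₂ u ^ 2) / (1 - 4 * μ₂ 0 * u) ^ 2 -
        (6 * μ₄ 0 * (2 / (1 - 4 * μ₂ 0 * u) ^ 2) -
          45 * μ₆ 0 * (↑(2 : ℕ) * zetaF (μ₂ 0) u ^ (2 - 1) * (2 / (1 - 4 * μ₂ 0 * u) ^ 2)) -
          192 * μ₄ 0 ^ 2 * (↑(3 : ℕ) * zetaF (μ₂ 0) u ^ (3 - 1) * (2 / (1 - 4 * μ₂ 0 * u) ^ 2))) := by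
    intro u hu
    have hm := h.mhat_nonneg hu
    have hmle := h.mhat_le hu
    have h4ge := h.hat4_ge hu
    have hm2 : mhat (μ₂ 0) μ₂ u ^ 2 ≤ (6 * μ₄ 0 * zetaF (μ₂ 0) u) ^ 2 :=
      pow_le_pow_left₀ hm hmle 2
    have heq : (12 * hat 4 (μ₂ 0) μ₄ u - 4 * mhat (μ₂ 0) μ₂ u ^ 2) / (1 - 4 * μ₂ 0 * u) ^ 2 -
        (6 * μ₄ 0 * (2 / (1 - 4 * μ₂ 0 * u) ^ 2) -
          45 * μ₆ 0 * (↑(2 : ℕ) * zetaF (μ₂ 0) u ^ (2 - 1) * (2 / (1 - 4 * μ₂ 0 * u) ^ 2)) -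
          192 * μ₄ 0 ^ 2 * (↑(3 : ℕ) * zetaF (μ₂ 0) u ^ (3 - 1) * (2 / (1 - 4 * μ₂ 0 * u) ^ 2))) =
        (12 * (hat 4 (μ₂ 0) μ₄ u - (μ₄ 0 - 15 * μ₆ 0 * zetaF (μ₂ 0) u -
            84 * μ₄ 0 ^ 2 * zetaF (μ₂ 0) u ^ 2)) +
          4 * ((6 * μ₄ 0 * zetaF (μ₂ 0) u) ^ 2 - mhat (μ₂ 0) μ₂ u ^ 2)) *
          ((1 - 4 * μ₂ 0 * u) ^ 2)⁻¹ := by push_cast; ring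
    rw [heq]
    refine mul_nonneg ?_ (inv_nonneg.2 (sq_nonneg _))
    nlinarith
  have key := apply_zero_le_of_hasDerivAt_nonneg hG hG' ht
  simp only [zetaF_zero, mul_zero, mhat_zero, ne_eq, OfNat.ofNat_ne_zero,
    not_false_eq_true, zero_pow, sub_self] at key
  linarith

/-- **(3.36)**: `μ̂₆ ≥ A₆ + (8A₄² - 28A₈)ζ - 492A₄A₆ζ² - 1536A₄³ζ³` (via `μ̂₄² ≥ 2A₄μ̂₄ - A₄²`).
[cite: HaraHattoriWatanabe2001, §3.2 eq. (3.36)] -/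
theorem hat6_ge (h : TruncFlow T μ₂ μ₄ μ₆ μ₈ μ₁₀) {t : ℝ} (ht : t ∈ Icc (0 : ℝ) T) :
    μ₆ 0 + (8 * μ₄ 0 ^ 2 - 28 * μ₈ 0) * zetaF (μ₂ 0) t - 492 * μ₄ 0 * μ₆ 0 * zetaF (μ₂ 0) t ^ 2 -
        1536 * μ₄ 0 ^ 3 * zetaF (μ₂ 0) t ^ 3 ≤ hat 6 (μ₂ 0) μ₆ t := by
  have hG : ∀ u ∈ Icc (0 : ℝ) T,
      HasDerivAt (fun u => hat 6 (μ₂ 0) μ₆ u - (μ₆ 0 + (8 * μ₄ 0 ^ 2 - 28 * μ₈ 0) * zetaF (μ₂ 0) u -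
        492 * μ₄ 0 * μ₆ 0 * zetaF (μ₂ 0) u ^ 2 - 1536 * μ₄ 0 ^ 3 * zetaF (μ₂ 0) u ^ 3))
      ((16 * hat 4 (μ₂ 0) μ₄ u ^ 2 - 24 * mhat (μ₂ 0) μ₂ u * hat 6 (μ₂ 0) μ₆ u -
          56 * hat 8 (μ₂ 0) μ₈ u) / (1 - 4 * μ₂ 0 * u) ^ 2 -
        ((8 * μ₄ 0 ^ 2 - 28 * μ₈ 0) * (2 / (1 - 4 * μ₂ 0 * u) ^ 2) -
          492 * μ₄ 0 * μ₆ 0 * (↑(2 : ℕ) * zetaF (μ₂ 0) u ^ (2 - 1) * (2 / (1 - 4 * μ₂ 0 * u) ^ 2)) -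
          1536 * μ₄ 0 ^ 3 * (↑(3 : ℕ) * zetaF (μ₂ 0) u ^ (3 - 1) * (2 / (1 - 4 * μ₂ 0 * u) ^ 2)))) u := by
    intro u hu
    have hz := hasDerivAt_zetaF (h.D_pos hu).ne'
    exact (h.hasDerivAt_hat6 hu).sub
      ((((hz.const_mul _).const_add _).sub ((hz.pow 2).const_mul _)).sub ((hz.pow 3).const_mul _))
  have hG' : ∀ u ∈ Icc (0 : ℝ) T, 0 ≤
      (16 * hat 4 (μ₂ 0) μ₄ u ^ 2 - 24 * mhat (μ₂ 0) μ₂ u * hat 6 (μ₂ 0) μ₆ u -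
          56 * hat 8 (μ₂ 0) μ₈ u) / (1 - 4 * μ₂ 0 * u) ^ 2 -
        ((8 * μ₄ 0 ^ 2 - 28 * μ₈ 0) * (2 / (1 - 4 * μ₂ 0 * u) ^ 2) -
          492 * μ₄ 0 * μ₆ 0 * (↑(2 : ℕ) * zetaF (μ₂ 0) u ^ (2 - 1) * (2 / (1 - 4 * μ₂ 0 * u) ^ 2)) -
          1536 * μ₄ 0 ^ 3 * (↑(3 : ℕ) * zetaF (μ₂ 0) u ^ (3 - 1) * (2 / (1 - 4 * μ₂ 0 * u) ^ 2))) := by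
    intro u hu
    have hm := h.mhat_nonneg hu
    have h6 := h.hat_nonneg 6 hu (h.six_nonneg u hu)
    have hA4 : 0 ≤ μ₄ 0 := h.four_nonneg 0 ⟨le_rfl, h.pos.le⟩
    have hζ := h.zetaF_nonneg hu
    have hsq : 2 * μ₄ 0 * hat 4 (μ₂ 0) μ₄ u - μ₄ 0 ^ 2 ≤ hat 4 (μ₂ 0) μ₄ u ^ 2 := by
      nlinarith [sq_nonneg (hat 4 (μ₂ 0) μ₄ u - μ₄ 0)]
    have hlin : 2 * μ₄ 0 * (μ₄ 0 - 15 * μ₆ 0 * zetaF (μ₂ 0) u - 84 * μ₄ 0 ^ 2 * zetaF (μ₂ 0) u ^ 2) ≤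
        2 * μ₄ 0 * hat 4 (μ₂ 0) μ₄ u :=
      mul_le_mul_of_nonneg_left (h.hat4_ge hu) (by positivity)
    have hm6 : mhat (μ₂ 0) μ₂ u * hat 6 (μ₂ 0) μ₆ u ≤
        6 * μ₄ 0 * zetaF (μ₂ 0) u * (μ₆ 0 + 8 * μ₄ 0 ^ 2 * zetaF (μ₂ 0) u) :=
      mul_le_mul (h.mhat_le hu) (h.hat6_le hu) h6 (by positivity)
    have h8le := h.hat8_le hu
    have heq : (16 * hat 4 (μ₂ 0) μ₄ u ^ 2 - 24 * mhat (μ₂ 0) μ₂ u * hat 6 (μ₂ 0) μ₆ u -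
          56 * hat 8 (μ₂ 0) μ₈ u) / (1 - 4 * μ₂ 0 * u) ^ 2 -
        ((8 * μ₄ 0 ^ 2 - 28 * μ₈ 0) * (2 / (1 - 4 * μ₂ 0 * u) ^ 2) -
          492 * μ₄ 0 * μ₆ 0 * (↑(2 : ℕ) * zetaF (μ₂ 0) u ^ (2 - 1) * (2 / (1 - 4 * μ₂ 0 * u) ^ 2)) -
          1536 * μ₄ 0 ^ 3 * (↑(3 : ℕ) * zetaF (μ₂ 0) u ^ (3 - 1) * (2 / (1 - 4 * μ₂ 0 * u) ^ 2))) =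
        (16 * hat 4 (μ₂ 0) μ₄ u ^ 2 - 24 * mhat (μ₂ 0) μ₂ u * hat 6 (μ₂ 0) μ₆ u -
          56 * hat 8 (μ₂ 0) μ₈ u - 16 * μ₄ 0 ^ 2 + 56 * μ₈ 0 +
          1968 * μ₄ 0 * μ₆ 0 * zetaF (μ₂ 0) u + 9216 * μ₄ 0 ^ 3 * zetaF (μ₂ 0) u ^ 2) *
          ((1 - 4 * μ₂ 0 * u) ^ 2)⁻¹ := by push_cast; ring
    rw [heq]
    refine mul_nonneg ?_ (inv_nonneg.2 (sq_nonneg _))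
    nlinarith
  have key := apply_zero_le_of_hasDerivAt_nonneg hG hG' ht
  simp only [zetaF_zero, mul_zero, hat_zero, add_zero, sub_zero, ne_eq, OfNat.ofNat_ne_zero,
    not_false_eq_true, zero_pow, sub_self] at key
  linarith

/-! ### (3.38): the refined upper bound for `μ̂₄` under (3.16) and (3.18) -/

/-- `ζ(T) > 0`. [folklore] -/
theorem zetaF_T_pos (h : TruncFlow T μ₂ μ₄ μ₆ μ₈ μ₁₀) : 0 < zetaF (μ₂ 0) T :=
  div_pos (by linarith [h.pos]) (h.D_pos ⟨h.pos.le, le_rfl⟩)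

/-- **(3.16) propagates**: if the lower bound (3.35) is non-negative at `t = T` it is non-negative
on `[0, T]` (it is non-increasing in `ζ ≥ 0`). [cite: HaraHattoriWatanabe2001, §3.2 (p. 10)] -/
theorem L4_nonneg (h : TruncFlow T μ₂ μ₄ μ₆ μ₈ μ₁₀)
    (h16 : 0 ≤ μ₄ 0 - 15 * μ₆ 0 * zetaF (μ₂ 0) T - 84 * μ₄ 0 ^ 2 * zetaF (μ₂ 0) T ^ 2)
    {t : ℝ} (ht : t ∈ Icc (0 : ℝ) T) :
    0 ≤ μ₄ 0 - 15 * μ₆ 0 * zetaF (μ₂ 0) t - 84 * μ₄ 0 ^ 2 * zetaF (μ₂ 0) t ^ 2 := by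
  have hζ := h.zetaF_nonneg ht
  have hζle := h.zetaF_le ht
  have hA6 : 0 ≤ μ₆ 0 := h.six_nonneg 0 ⟨le_rfl, h.pos.le⟩
  nlinarith [mul_nonneg hA6 (sub_nonneg.2 hζle),
    mul_nonneg (sq_nonneg (μ₄ 0)) (mul_nonneg (sub_nonneg.2 hζle) (add_nonneg hζ h.zetaF_T_pos.le))]

/-- **(3.18) propagates**: if the lower bound (3.37) is non-negative at `t = T` it is non-negative
on `[0, T]` (it is `ζ` times a non-increasing function of `ζ ≥ 0`).
[cite: HaraHattoriWatanabe2001, §3.2 (p. 10)] -/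
theorem Lm_nonneg (h : TruncFlow T μ₂ μ₄ μ₆ μ₈ μ₁₀)
    (h18 : 0 ≤ 6 * μ₄ 0 * zetaF (μ₂ 0) T - 45 * μ₆ 0 * zetaF (μ₂ 0) T ^ 2 -
      192 * μ₄ 0 ^ 2 * zetaF (μ₂ 0) T ^ 3)
    {t : ℝ} (ht : t ∈ Icc (0 : ℝ) T) :
    0 ≤ 6 * μ₄ 0 * zetaF (μ₂ 0) t - 45 * μ₆ 0 * zetaF (μ₂ 0) t ^ 2 -
      192 * μ₄ 0 ^ 2 * zetaF (μ₂ 0) t ^ 3 := by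
  have hζ := h.zetaF_nonneg ht
  have hζle := h.zetaF_le ht
  have hζT := h.zetaF_T_pos
  have hA6 : 0 ≤ μ₆ 0 := h.six_nonneg 0 ⟨le_rfl, h.pos.le⟩
  set Z := zetaF (μ₂ 0) T with hZ
  set z := zetaF (μ₂ 0) t with hz
  -- the second factor is non-negative at `Z` ...
  have hφT : 0 ≤ 6 * μ₄ 0 - 45 * μ₆ 0 * Z - 192 * μ₄ 0 ^ 2 * Z ^ 2 := by
    by_contra hneg
    push Not at hneg
    have : 6 * μ₄ 0 * Z - 45 * μ₆ 0 * Z ^ 2 - 192 * μ₄ 0 ^ 2 * Z ^ 3 =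
        Z * (6 * μ₄ 0 - 45 * μ₆ 0 * Z - 192 * μ₄ 0 ^ 2 * Z ^ 2) := by ring
    rw [this] at h18
    nlinarith [mul_pos hζT (neg_pos.2 hneg)]
  -- ... hence at `z ≤ Z`
  have hφ : 0 ≤ 6 * μ₄ 0 - 45 * μ₆ 0 * z - 192 * μ₄ 0 ^ 2 * z ^ 2 := by
    nlinarith [mul_nonneg hA6 (sub_nonneg.2 hζle),
      mul_nonneg (sq_nonneg (μ₄ 0)) (mul_nonneg (sub_nonneg.2 hζle) (add_nonneg hζ hζT.le))]
  have : 6 * μ₄ 0 * z - 45 * μ₆ 0 * z ^ 2 - 192 * μ₄ 0 ^ 2 * z ^ 3 =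
      z * (6 * μ₄ 0 - 45 * μ₆ 0 * z - 192 * μ₄ 0 ^ 2 * z ^ 2) := by ring
  rw [this]
  exact mul_nonneg hζ hφ

/-- **(3.38)**: under (3.16) (non-negativity of the lower bound (3.35) at `t = T`),
`μ̂₄ ≤ A₄ - 15A₆ζ - 84A₄²ζ² + 210A₈ζ² + 2820A₄A₆ζ³ + 7152A₄³ζ⁴`. (The paper also assumes (3.18),
non-negativity of the lower bound (3.37) for `m̂`; it is not needed, because
`m̂ μ̂₄ ≥ (3.37) × (3.35)` already follows from `m̂ ≥ 0` and `(3.35) ≥ 0`.)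
[cite: HaraHattoriWatanabe2001, §3.2 eq. (3.38)] -/
theorem hat4_le' (h : TruncFlow T μ₂ μ₄ μ₆ μ₈ μ₁₀)
    (h16 : 0 ≤ μ₄ 0 - 15 * μ₆ 0 * zetaF (μ₂ 0) T - 84 * μ₄ 0 ^ 2 * zetaF (μ₂ 0) T ^ 2)
    {t : ℝ} (ht : t ∈ Icc (0 : ℝ) T) :
    hat 4 (μ₂ 0) μ₄ t ≤ μ₄ 0 - 15 * μ₆ 0 * zetaF (μ₂ 0) t - 84 * μ₄ 0 ^ 2 * zetaF (μ₂ 0) t ^ 2 +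
      210 * μ₈ 0 * zetaF (μ₂ 0) t ^ 2 + 2820 * μ₄ 0 * μ₆ 0 * zetaF (μ₂ 0) t ^ 3 +
      7152 * μ₄ 0 ^ 3 * zetaF (μ₂ 0) t ^ 4 := by
  have hG : ∀ u ∈ Icc (0 : ℝ) T,
      HasDerivAt (fun u => μ₄ 0 - 15 * μ₆ 0 * zetaF (μ₂ 0) u - 84 * μ₄ 0 ^ 2 * zetaF (μ₂ 0) u ^ 2 +
        210 * μ₈ 0 * zetaF (μ₂ 0) u ^ 2 + 2820 * μ₄ 0 * μ₆ 0 * zetaF (μ₂ 0) u ^ 3 +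
        7152 * μ₄ 0 ^ 3 * zetaF (μ₂ 0) u ^ 4 - hat 4 (μ₂ 0) μ₄ u)
      (-(15 * μ₆ 0 * (2 / (1 - 4 * μ₂ 0 * u) ^ 2)) -
        84 * μ₄ 0 ^ 2 * (↑(2 : ℕ) * zetaF (μ₂ 0) u ^ (2 - 1) * (2 / (1 - 4 * μ₂ 0 * u) ^ 2)) +
        210 * μ₈ 0 * (↑(2 : ℕ) * zetaF (μ₂ 0) u ^ (2 - 1) * (2 / (1 - 4 * μ₂ 0 * u) ^ 2)) +
        2820 * μ₄ 0 * μ₆ 0 * (↑(3 : ℕ) * zetaF (μ₂ 0) u ^ (3 - 1) * (2 / (1 - 4 * μ₂ 0 * u) ^ 2)) +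
        7152 * μ₄ 0 ^ 3 * (↑(4 : ℕ) * zetaF (μ₂ 0) u ^ (4 - 1) * (2 / (1 - 4 * μ₂ 0 * u) ^ 2)) -
        (-16 * mhat (μ₂ 0) μ₂ u * hat 4 (μ₂ 0) μ₄ u - 30 * hat 6 (μ₂ 0) μ₆ u) /
          (1 - 4 * μ₂ 0 * u) ^ 2) u := by
    intro u hu
    have hz := hasDerivAt_zetaF (h.D_pos hu).ne'
    exact ((((((hz.const_mul _).const_sub _).sub ((hz.pow 2).const_mul _)).add
      ((hz.pow 2).const_mul _)).add ((hz.pow 3).const_mul _)).add ((hz.pow 4).const_mul _)).sub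
      (h.hasDerivAt_hat4 hu)
  have hG' : ∀ u ∈ Icc (0 : ℝ) T, 0 ≤
      -(15 * μ₆ 0 * (2 / (1 - 4 * μ₂ 0 * u) ^ 2)) -
        84 * μ₄ 0 ^ 2 * (↑(2 : ℕ) * zetaF (μ₂ 0) u ^ (2 - 1) * (2 / (1 - 4 * μ₂ 0 * u) ^ 2)) +
        210 * μ₈ 0 * (↑(2 : ℕ) * zetaF (μ₂ 0) u ^ (2 - 1) * (2 / (1 - 4 * μ₂ 0 * u) ^ 2)) +
        2820 * μ₄ 0 * μ₆ 0 * (↑(3 : ℕ) * zetaF (μ₂ 0) u ^ (3 - 1) * (2 / (1 - 4 * μ₂ 0 * u) ^ 2)) +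
        7152 * μ₄ 0 ^ 3 * (↑(4 : ℕ) * zetaF (μ₂ 0) u ^ (4 - 1) * (2 / (1 - 4 * μ₂ 0 * u) ^ 2)) -
        (-16 * mhat (μ₂ 0) μ₂ u * hat 4 (μ₂ 0) μ₄ u - 30 * hat 6 (μ₂ 0) μ₆ u) /
          (1 - 4 * μ₂ 0 * u) ^ 2 := by
    intro u hu
    have hm := h.mhat_nonneg hu
    have hζ := h.zetaF_nonneg hu
    have hA4 : 0 ≤ μ₄ 0 := h.four_nonneg 0 ⟨le_rfl, h.pos.le⟩
    have hA6 : 0 ≤ μ₆ 0 := h.six_nonneg 0 ⟨le_rfl, h.pos.le⟩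
    have hL4 := h.L4_nonneg h16 hu
    set z := zetaF (μ₂ 0) u with hz
    -- `m̂ μ̂₄ ≥ (lower bound (3.37)) × (lower bound (3.35))` (`m̂ ≥ 0`, `(3.35) ≥ 0`)
    have hm4 : (6 * μ₄ 0 * z - 45 * μ₆ 0 * z ^ 2 - 192 * μ₄ 0 ^ 2 * z ^ 3) *
        (μ₄ 0 - 15 * μ₆ 0 * z - 84 * μ₄ 0 ^ 2 * z ^ 2) ≤
        mhat (μ₂ 0) μ₂ u * hat 4 (μ₂ 0) μ₄ u :=
      mul_le_mul (h.mhat_ge hu) (h.hat4_ge hu) hL4 hm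
    -- the product, minus its non-negative top-order terms
    have hk : (6 * μ₄ 0 * z - 45 * μ₆ 0 * z ^ 2 - 192 * μ₄ 0 ^ 2 * z ^ 3) *
        (μ₄ 0 - 15 * μ₆ 0 * z - 84 * μ₄ 0 ^ 2 * z ^ 2) =
        (6 * μ₄ 0 ^ 2 * z - 135 * μ₄ 0 * μ₆ 0 * z ^ 2 - 696 * μ₄ 0 ^ 3 * z ^ 3) +
        (675 * μ₆ 0 ^ 2 * z ^ 3 + 6660 * μ₄ 0 ^ 2 * μ₆ 0 * z ^ 4 + 16128 * μ₄ 0 ^ 4 * z ^ 5) := by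
      ring
    have hdrop : 0 ≤ 675 * μ₆ 0 ^ 2 * z ^ 3 + 6660 * μ₄ 0 ^ 2 * μ₆ 0 * z ^ 4 +
        16128 * μ₄ 0 ^ 4 * z ^ 5 :=
      add_nonneg (add_nonneg (mul_nonneg (mul_nonneg (by norm_num) (sq_nonneg _)) (pow_nonneg hζ 3))
        (mul_nonneg (mul_nonneg (mul_nonneg (by norm_num) (sq_nonneg _)) hA6) (pow_nonneg hζ 4)))
        (mul_nonneg (mul_nonneg (by norm_num) (pow_nonneg hA4 4)) (pow_nonneg hζ 5))
    have h6ge := h.hat6_ge hu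
    have heq : -(15 * μ₆ 0 * (2 / (1 - 4 * μ₂ 0 * u) ^ 2)) -
        84 * μ₄ 0 ^ 2 * (↑(2 : ℕ) * z ^ (2 - 1) * (2 / (1 - 4 * μ₂ 0 * u) ^ 2)) +
        210 * μ₈ 0 * (↑(2 : ℕ) * z ^ (2 - 1) * (2 / (1 - 4 * μ₂ 0 * u) ^ 2)) +
        2820 * μ₄ 0 * μ₆ 0 * (↑(3 : ℕ) * z ^ (3 - 1) * (2 / (1 - 4 * μ₂ 0 * u) ^ 2)) +
        7152 * μ₄ 0 ^ 3 * (↑(4 : ℕ) * z ^ (4 - 1) * (2 / (1 - 4 * μ₂ 0 * u) ^ 2)) -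
        (-16 * mhat (μ₂ 0) μ₂ u * hat 4 (μ₂ 0) μ₄ u - 30 * hat 6 (μ₂ 0) μ₆ u) /
          (1 - 4 * μ₂ 0 * u) ^ 2 =
        (2 * (-15 * μ₆ 0 - 168 * μ₄ 0 ^ 2 * z + 420 * μ₈ 0 * z + 8460 * μ₄ 0 * μ₆ 0 * z ^ 2 +
            28608 * μ₄ 0 ^ 3 * z ^ 3) +
          16 * (mhat (μ₂ 0) μ₂ u * hat 4 (μ₂ 0) μ₄ u) + 30 * hat 6 (μ₂ 0) μ₆ u) *
          ((1 - 4 * μ₂ 0 * u) ^ 2)⁻¹ := by push_cast; ring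
    rw [heq]
    refine mul_nonneg ?_ (inv_nonneg.2 (sq_nonneg _))
    rw [hk] at hm4
    linarith
  have key := apply_zero_le_of_hasDerivAt_nonneg hG hG' ht
  simp only [zetaF_zero, mul_zero, hat_zero, sub_zero, add_zero, ne_eq, OfNat.ofNat_ne_zero,
    not_false_eq_true, zero_pow, sub_self] at key
  linarith

/-! ### The conclusions of Proposition 3.1 at `t = T` -/

/-- `T ∈ [0, T]`. [folklore] -/
theorem T_mem (h : TruncFlow T μ₂ μ₄ μ₆ μ₈ μ₁₀) : T ∈ Icc (0 : ℝ) T := ⟨h.pos.le, le_rfl⟩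

/-- `μ_k = μ̂_k M^k`. [folklore] -/
theorem eq_hat_mul (k : ℕ) (a : ℝ) (μ : ℝ → ℝ) {t : ℝ} (hD : 1 - 4 * a * t ≠ 0) :
    μ t = hat k a μ t * bigM a t ^ k := by
  unfold hat bigM
  rw [inv_pow, mul_assoc, mul_inv_cancel₀ (pow_ne_zero k hD), mul_one]

/-- `μ₂ = aM - m̂M²`. [folklore] -/
theorem two_eq_of (a : ℝ) (μ₂ : ℝ → ℝ) {t : ℝ} (hD : 1 - 4 * a * t ≠ 0) :
    μ₂ t = a * bigM a t - mhat a μ₂ t * bigM a t ^ 2 := by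
  unfold mhat bigM
  rw [eq_comm, ← sub_eq_zero]
  have : a * (1 - 4 * a * t)⁻¹ - (a * (1 - 4 * a * t) - μ₂ t * (1 - 4 * a * t) ^ 2) *
      (1 - 4 * a * t)⁻¹ ^ 2 - μ₂ t =
      a * (1 - 4 * a * t)⁻¹ * (1 - (1 - 4 * a * t) * (1 - 4 * a * t)⁻¹) +
        μ₂ t * (((1 - 4 * a * t) * (1 - 4 * a * t)⁻¹) ^ 2 - 1) := by ring
  rw [this, mul_inv_cancel₀ hD]
  ring

/-- **(3.14)**: `μ₂(T) ≤ a M_T` (`= r_N μ_{2,N}`). [cite: HaraHattoriWatanabe2001, Proposition 3.1 (3.14)] -/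
theorem two_T_le (h : TruncFlow T μ₂ μ₄ μ₆ μ₈ μ₁₀) : μ₂ T ≤ μ₂ 0 * bigM (μ₂ 0) T :=
  h.two_le h.T_mem

/-- **(3.15)**: `μ₂(T) ≥ a M_T - 6A₄ζ_T M_T²` (`= r_N μ_{2,N} - 3r_N²ζ_N μ_{4,N}`).
[cite: HaraHattoriWatanabe2001, Proposition 3.1 (3.15)] -/
theorem two_T_ge (h : TruncFlow T μ₂ μ₄ μ₆ μ₈ μ₁₀) :
    μ₂ 0 * bigM (μ₂ 0) T - 6 * μ₄ 0 * zetaF (μ₂ 0) T * bigM (μ₂ 0) T ^ 2 ≤ μ₂ T := by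
  have hD := (h.D_pos h.T_mem).ne'
  rw [two_eq_of (μ₂ 0) μ₂ hD]
  nlinarith [mul_le_mul_of_nonneg_right (h.mhat_le h.T_mem) (sq_nonneg (bigM (μ₂ 0) T))]

/-- **(3.19)**: `μ₂(T) ≤ a M_T - M_T²(6A₄ζ_T - 45A₆ζ_T² - 192A₄²ζ_T³)`.
[cite: HaraHattoriWatanabe2001, Proposition 3.1 (3.19)] -/
theorem two_T_le' (h : TruncFlow T μ₂ μ₄ μ₆ μ₈ μ₁₀) :
    μ₂ T ≤ μ₂ 0 * bigM (μ₂ 0) T - (6 * μ₄ 0 * zetaF (μ₂ 0) T - 45 * μ₆ 0 * zetaF (μ₂ 0) T ^ 2 -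
      192 * μ₄ 0 ^ 2 * zetaF (μ₂ 0) T ^ 3) * bigM (μ₂ 0) T ^ 2 := by
  have hD := (h.D_pos h.T_mem).ne'
  rw [two_eq_of (μ₂ 0) μ₂ hD]
  nlinarith [mul_le_mul_of_nonneg_right (h.mhat_ge h.T_mem) (sq_nonneg (bigM (μ₂ 0) T))]

/-- **(3.20)**: `μ₄(T) ≥ M_T⁴(A₄ - 15A₆ζ_T - 84A₄²ζ_T²)`.
[cite: HaraHattoriWatanabe2001, Proposition 3.1 (3.20)] -/
theorem four_T_ge (h : TruncFlow T μ₂ μ₄ μ₆ μ₈ μ₁₀) :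
    (μ₄ 0 - 15 * μ₆ 0 * zetaF (μ₂ 0) T - 84 * μ₄ 0 ^ 2 * zetaF (μ₂ 0) T ^ 2) *
      bigM (μ₂ 0) T ^ 4 ≤ μ₄ T := by
  have hD := (h.D_pos h.T_mem).ne'
  rw [eq_hat_mul 4 (μ₂ 0) μ₄ hD]
  exact mul_le_mul_of_nonneg_right (h.hat4_ge h.T_mem) (pow_nonneg (h.bigM_pos h.T_mem).le 4)

/-- **(3.21)**: under (3.16) (non-negativity of the lower bound (3.35) at `t = T`),
`μ₄(T) ≤ M_T⁴(A₄ - 15A₆ζ_T - 84A₄²ζ_T² + 210A₈ζ_T² + 2820A₄A₆ζ_T³ + 7152A₄³ζ_T⁴)`; the paper's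
extra hypotheses (3.17), (3.18) are not needed for this conclusion.
[cite: HaraHattoriWatanabe2001, Proposition 3.1 (3.16), (3.21)] -/
theorem four_T_le (h : TruncFlow T μ₂ μ₄ μ₆ μ₈ μ₁₀)
    (h16 : 0 ≤ μ₄ 0 - 15 * μ₆ 0 * zetaF (μ₂ 0) T - 84 * μ₄ 0 ^ 2 * zetaF (μ₂ 0) T ^ 2) :
    μ₄ T ≤ (μ₄ 0 - 15 * μ₆ 0 * zetaF (μ₂ 0) T - 84 * μ₄ 0 ^ 2 * zetaF (μ₂ 0) T ^ 2 +
      210 * μ₈ 0 * zetaF (μ₂ 0) T ^ 2 + 2820 * μ₄ 0 * μ₆ 0 * zetaF (μ₂ 0) T ^ 3 +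
      7152 * μ₄ 0 ^ 3 * zetaF (μ₂ 0) T ^ 4) * bigM (μ₂ 0) T ^ 4 := by
  have hD := (h.D_pos h.T_mem).ne'
  rw [eq_hat_mul 4 (μ₂ 0) μ₄ hD]
  exact mul_le_mul_of_nonneg_right (h.hat4_le' h16 h.T_mem)
    (pow_nonneg (h.bigM_pos h.T_mem).le 4)

/-- **(3.22)**: `μ₆(T) ≤ M_T⁶(A₆ + 8A₄²ζ_T)`. [cite: HaraHattoriWatanabe2001, Proposition 3.1 (3.22)] -/
theorem six_T_le (h : TruncFlow T μ₂ μ₄ μ₆ μ₈ μ₁₀) :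
    μ₆ T ≤ (μ₆ 0 + 8 * μ₄ 0 ^ 2 * zetaF (μ₂ 0) T) * bigM (μ₂ 0) T ^ 6 := by
  have hD := (h.D_pos h.T_mem).ne'
  rw [eq_hat_mul 6 (μ₂ 0) μ₆ hD]
  exact mul_le_mul_of_nonneg_right (h.hat6_le h.T_mem) (pow_nonneg (h.bigM_pos h.T_mem).le 6)

/-- **(3.23)**: `μ₆(T) ≥ M_T⁶(A₆ + (8A₄² - 28A₈)ζ_T - 492A₄A₆ζ_T² - 1536A₄³ζ_T³)`.
[cite: HaraHattoriWatanabe2001, Proposition 3.1 (3.23)] -/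
theorem six_T_ge (h : TruncFlow T μ₂ μ₄ μ₆ μ₈ μ₁₀) :
    (μ₆ 0 + (8 * μ₄ 0 ^ 2 - 28 * μ₈ 0) * zetaF (μ₂ 0) T - 492 * μ₄ 0 * μ₆ 0 * zetaF (μ₂ 0) T ^ 2 -
        1536 * μ₄ 0 ^ 3 * zetaF (μ₂ 0) T ^ 3) * bigM (μ₂ 0) T ^ 6 ≤ μ₆ T := by
  have hD := (h.D_pos h.T_mem).ne'
  rw [eq_hat_mul 6 (μ₂ 0) μ₆ hD]
  exact mul_le_mul_of_nonneg_right (h.hat6_ge h.T_mem) (pow_nonneg (h.bigM_pos h.T_mem).le 6)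

/-- **(3.24)**: `μ₈(T) ≤ M_T⁸(A₈ + 24A₄A₆ζ_T + 96A₄³ζ_T²)`.
[cite: HaraHattoriWatanabe2001, Proposition 3.1 (3.24)] -/
theorem eight_T_le (h : TruncFlow T μ₂ μ₄ μ₆ μ₈ μ₁₀) :
    μ₈ T ≤ (μ₈ 0 + 24 * μ₄ 0 * μ₆ 0 * zetaF (μ₂ 0) T + 96 * μ₄ 0 ^ 3 * zetaF (μ₂ 0) T ^ 2) *
      bigM (μ₂ 0) T ^ 8 := by
  have hD := (h.D_pos h.T_mem).ne'
  rw [eq_hat_mul 8 (μ₂ 0) μ₈ hD]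
  exact mul_le_mul_of_nonneg_right (h.hat8_le h.T_mem) (pow_nonneg (h.bigM_pos h.T_mem).le 8)

end TruncFlow

end HierarchicalRG

end Literature.Barriers.CriticalPhenomena
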